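import Mathlib
import Literature.NumberTheory.LFunctions.HybridCharSumRoots
import HarnessLib

/-!
# The `L`-function of the exponential sums `Σ_x ψ(Tr P(x)/Q(x))` of a rational function
# (Schmidt, Ch. II §§8–10, for rational arguments)

Topic `Literature/NumberTheory/LFunctions` (exponential sums), grouping namespace
`RationalExpSum`.  Second file of the elementary treatment of Weil's bound
`|Σ_{x ∈ 𝔽_p, Q(x) ≠ 0} ψ(P(x)/Q(x))| ≤ c(deg) √p` (A. Weil 1948) through the `L`-function
formalism of W. M. Schmidt, *Equations over finite fields*, LNM 536 (1976), Ch. II §§8–10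
(there for polynomial arguments and, §12, for Kloosterman sums; the tree's
`KloostermanLFunction`, `HybridCharSumLFunction`).  For a rational function `R = P/Q` over a
finite field `F` and an additive character `ψ` we define

* `traceTerm P Q π = Tr_{F[X]/(π) / F}(P(θ)/Q(θ))` for a monic irreducible `π` (`θ` its
  root) — Schmidt's `[g/h]` for `g = R` rational, at an irreducible `h = π`;
* `lam ψ P Q h = Π_{π^e ∥ h} λ₀(π)^e` with `λ₀(π) = ψ(traceTerm P Q π)` if `π ∤ Q` and `0` if
  `π ∣ Q`, a completely multiplicative function on monic polynomials (`isMonicMul_lam`), defined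
  through the normalised factorisation;
* `extSum ψ P Q E = Σ_{x ∈ E, Q(x) ≠ 0} ψ(Tr_{E/F}(P(x)/Q(x)))`, the sum lifted to a finite
  extension `E/F`;

and PROVE **`extSum ψ P Q E = psumOf (lam ψ P Q) [E : F]`** (`extSum_eq_psumOf`; Schmidt II §10,
Theorem 10A: group `x` by its minimal polynomial `π`; a monic irreducible `π` of degree `d ∣ ν`
has `d` roots in `E`, all poles if `π ∣ Q` and none otherwise, each contributing
`ψ(Tr R(x)) = ψ((ν/d) · traceTerm P Q π) = λ₀(π)^{ν/d}`).  Hence, by the tree's von Mangoldt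
identity and power-sum algebra (`HybridLFunction.exists_psumOf_eq_neg_powerSum`), as soon as the
coefficients `lsumOf (lam ψ P Q) n` vanish for `n > ℓ`, the sums over all extensions are
`−Σ_{i ≤ ℓ} ωᵢ^{[E:F]}` (`exists_extSum_eq_neg_powerSum`).  The vanishing (the character structure
of `lam` modulo `Q · rad Q`) is the subject of `RationalExpSumCharacter`.

Everything here is proved; no named facts.

## References

* W. M. Schmidt, *Equations over Finite Fields. An Elementary Approach*, LNM 536 (1976),
  Ch. II §8 (Theorems 8A, 8B), §10 (Theorem 10A, (10.5)). [`Schmidt1976`]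
* A. Weil, *On some exponential sums*, Proc. Nat. Acad. Sci. USA 34 (1948) 204–207. [`Weil1948`]
-/

noncomputable section

open Finset Polynomial

namespace Literature.NumberTheory.LFunctions

namespace RationalExpSum

open KloostermanLFunction (monics mem_monics irrMonicsLE mem_irrMonicsLE
  one_le_natDegree_of_irreducible card_filter_aeval_eq_zero natDegree_minpoly_mul_finrank
  minpoly_eq_of_aeval_eq_zero)
open HybridLFunction (IsMonicMul lsumOf psumOf)
open UniqueFactorizationMonoid

/-! ### §1. The trace term and the multiplicative function `λ` -/

section Lam

variable {F : Type*} [Field F]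

/-- **The trace term** `Tr_{F[X]/(π) / F}(P(θ) / Q(θ))` of the rational function `P/Q` at a
monic irreducible `π` (`θ = X mod π`; Schmidt's `[g/h] = Σ_{h(β)=0} g(β)` at `h = π`, for the
rational `g = P/Q`); `0` if `π` is not irreducible. [cite: Schmidt1976, Ch. II §9 p. 64 and §10 (10.5)] -/
def traceTerm (P Q π : F[X]) : F :=
  open scoped Classical in
  if hπ : Irreducible π then
    haveI := Fact.mk hπ
    Algebra.trace F (AdjoinRoot π) (AdjoinRoot.mk π P / AdjoinRoot.mk π Q)
  else 0

open scoped Classical in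
/-- The local factor `λ₀(π) = ψ(traceTerm P Q π)` for `π ∤ Q`, and `0` for `π ∣ Q` (the poles).
[cite: Schmidt1976, Ch. II §8 (the convention `X(h) = 0` off the group)] -/
def lamIrr (ψ : AddChar F ℂ) (P Q π : F[X]) : ℂ :=
  if π ∣ Q then 0 else ψ (traceTerm P Q π)

variable [DecidableEq F]

/-- **`λ(h) = Π_{π ∈ normalizedFactors h} λ₀(π)`** (with multiplicity): the completely
multiplicative function on monic polynomials attached to `ψ` and `P/Q`.
[cite: Schmidt1976, Ch. II §8, p. 63] -/
def lam (ψ : AddChar F ℂ) (P Q h : F[X]) : ℂ :=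
  ((normalizedFactors h).map (lamIrr ψ P Q)).prod

/-- `λ(1) = 1`. [folklore] -/
theorem lam_one (ψ : AddChar F ℂ) (P Q : F[X]) : lam ψ P Q 1 = 1 := by
  unfold lam; rw [normalizedFactors_one, Multiset.map_zero, Multiset.prod_zero]

/-- `λ(gh) = λ(g) λ(h)` for `g, h ≠ 0` (in particular for monic `g, h`). [cite: Schmidt1976, Ch. II §8, p. 63] -/
theorem lam_mul (ψ : AddChar F ℂ) (P Q : F[X]) {g h : F[X]} (hg : g ≠ 0) (hh : h ≠ 0) :
    lam ψ P Q (g * h) = lam ψ P Q g * lam ψ P Q h := by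
  unfold lam; rw [normalizedFactors_mul hg hh, Multiset.map_add, Multiset.prod_add]

/-- `λ` is completely multiplicative on monic polynomials. [cite: Schmidt1976, Ch. II §8, p. 63] -/
theorem isMonicMul_lam (ψ : AddChar F ℂ) (P Q : F[X]) : IsMonicMul (lam ψ P Q) :=
  ⟨lam_one ψ P Q, fun hg hh => lam_mul ψ P Q hg.ne_zero hh.ne_zero⟩

/-- On a monic irreducible `π`, `λ(π) = λ₀(π)`. [folklore] -/
theorem lam_of_irreducible (ψ : AddChar F ℂ) (P Q : F[X]) {π : F[X]} (hm : π.Monic)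
    (hirr : Irreducible π) : lam ψ P Q π = lamIrr ψ P Q π := by
  unfold lam
  rw [normalizedFactors_irreducible hirr, hm.normalize_eq_self, Multiset.map_singleton,
    Multiset.prod_singleton]

omit [DecidableEq F] in
/-- `|λ₀(π)| ≤ 1`. [folklore] -/
theorem norm_lamIrr_le (ψ : AddChar F ℂ) (P Q π : F[X]) [Finite F] : ‖lamIrr ψ P Q π‖ ≤ 1 := by
  classical
  unfold lamIrr
  split_ifs
  · simp
  · exact (AddChar.norm_apply _ _).le

end Lam

/-! ### §2. Traces of `R(x)` in a finite extension -/

section Trace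

variable {F : Type*} [Field F]
variable {E : Type*} [Field E] [Algebra F E] [FiniteDimensional F E]

open IntermediateField

/-- **Schmidt II (10.5) for a rational function**: for `x ∈ E` with minimal polynomial `π` and
`Q(x) ≠ 0`, `Tr_{E/F}(P(x)/Q(x)) = [E : F(x)] · traceTerm P Q π`.
[cite: Schmidt1976, Ch. II §10, (10.5)] -/
theorem trace_div_eq (P Q : F[X]) (x : E) :
    Algebra.trace F E (aeval x P / aeval x Q) =
      Module.finrank F⟮x⟯ E • traceTerm P Q (minpoly F x) := by
  have hint : IsIntegral F x := .of_finite F x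
  have hirr : Irreducible (minpoly F x) := minpoly.irreducible hint
  haveI : Fact (Irreducible (minpoly F x)) := ⟨hirr⟩
  -- the element `R(x)` lies in `F(x)`: it is the image of `P(gen)/Q(gen)`
  set y : F⟮x⟯ := aeval (AdjoinSimple.gen F x) P / aeval (AdjoinSimple.gen F x) Q with hy
  have hyE : algebraMap F⟮x⟯ E y = aeval x P / aeval x Q := by
    rw [hy, map_div₀, ← aeval_algebraMap_apply, ← aeval_algebraMap_apply,
      AdjoinSimple.algebraMap_gen]
  -- `Tr_{E/F} = [E : F(x)] Tr_{F(x)/F}` on `F(x)`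
  have htr : Algebra.trace F E (algebraMap F⟮x⟯ E y) = Module.finrank F⟮x⟯ E • Algebra.trace F F⟮x⟯ y := by
    rw [← Algebra.trace_trace (S := F⟮x⟯), Algebra.trace_algebraMap, map_nsmul]
  rw [← hyE, htr]
  congr 1
  -- `Tr_{F(x)/F}(y) = Tr_{F[X]/(π)}(P/Q mod π)` through `AdjoinRoot π ≃ F(x)`
  unfold traceTerm
  rw [dif_pos hirr]
  set e := adjoinRootEquivAdjoin F hint with he
  have hey : e (AdjoinRoot.mk (minpoly F x) P / AdjoinRoot.mk (minpoly F x) Q) = y := by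
    rw [map_div₀, ← AdjoinRoot.aeval_eq, ← AdjoinRoot.aeval_eq, ← aeval_algHom_apply,
      ← aeval_algHom_apply, he, adjoinRootEquivAdjoin_apply_root]
  rw [← hey, Algebra.trace_eq_of_algEquiv]

omit [FiniteDimensional F E] in
/-- `Q(x) = 0 ↔ minpoly x ∣ Q`. [folklore] -/
theorem aeval_eq_zero_iff_minpoly_dvd (Q : F[X]) (x : E) : aeval x Q = 0 ↔ minpoly F x ∣ Q :=
  ⟨fun h => minpoly.dvd F x h, fun h => by
    obtain ⟨k, hk⟩ := h
    rw [hk, map_mul, minpoly.aeval, zero_mul]⟩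

end Trace

/-! ### §3. The lifted sums `S_E = Σ_{x ∈ E, Q(x) ≠ 0} ψ(Tr_{E/F} P(x)/Q(x))` -/

section Extension

variable {F : Type*} [Field F] [Fintype F] [DecidableEq F]

open IntermediateField

/-- **The lifted exponential sum** of the rational function `P/Q` over a finite extension `E/F`:
`S_E = Σ_{x ∈ E, Q(x) ≠ 0} ψ(Tr_{E/F}(P(x)/Q(x)))` (Schmidt's `S_ν` with `ψ_ν = ψ ∘ 𝔗`, §10 (10.3)).
[cite: Schmidt1976, Ch. II §10, (10.3)] -/
def extSum (ψ : AddChar F ℂ) (P Q : F[X]) (E : Type*) [Field E] [Fintype E] [Algebra F E] : ℂ := by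
  classical
  exact ∑ x ∈ univ.filter (fun x : E => aeval x Q ≠ 0),
    ψ (Algebra.trace F E (aeval x P / aeval x Q))

/-- **`S_E = s_{[E:F]}`** (Schmidt II §10, Theorem 10A, for the `L`-function of `P/Q`): group
`x ∈ E` with `Q(x) ≠ 0` by minimal polynomials; a monic irreducible `π ∤ Q` of degree `d ∣ ν`
has `d` roots, each contributing `ψ(traceTerm)^{ν/d} = λ(π)^{ν/d}`, and `π ∣ Q` contributes
nothing on either side. [cite: Schmidt1976, Ch. II §10, Theorem 10A] -/
theorem extSum_eq_psumOf (ψ : AddChar F ℂ) (P Q : F[X]) (E : Type*) [Field E] [Fintype E]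
    [Algebra F E] : extSum ψ P Q E = psumOf (lam ψ P Q) (Module.finrank F E) := by
  classical
  set ν := Module.finrank F E with hν
  have hνpos : 0 < ν := Module.finrank_pos
  have hmem : ∀ x : E, minpoly F x ∈ irrMonicsLE (F := F) ν := by
    intro x
    rw [mem_irrMonicsLE]
    refine ⟨minpoly.monic (.of_finite F x), minpoly.irreducible (.of_finite F x), ?_⟩
    exact Nat.le_of_dvd hνpos (Dvd.intro _ (natDegree_minpoly_mul_finrank x))
  unfold extSum
  rw [← Finset.sum_fiberwise_of_maps_to (g := fun x : E => minpoly F x)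
    (t := irrMonicsLE (F := F) ν) (fun x _ => hmem x)]
  have hpsum : psumOf (lam ψ P Q) ν = ∑ π ∈ irrMonicsLE (F := F) ν,
      if π.natDegree ∣ ν then (π.natDegree : ℂ) * lam ψ P Q π ^ (ν / π.natDegree) else 0 := by
    unfold psumOf
    rw [Finset.sum_filter, Finset.sum_product]
    refine Finset.sum_congr rfl fun π hπ => ?_
    dsimp only
    have hk : 1 ≤ π.natDegree := one_le_natDegree_of_irreducible (mem_irrMonicsLE.mp hπ).2.1
    split_ifs with hdvd
    · rw [Finset.sum_eq_single (ν / π.natDegree)]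
      · rw [if_pos (Nat.div_mul_cancel hdvd)]
      · intro j _ hj
        rw [if_neg]
        intro h
        exact hj (Nat.div_eq_of_eq_mul_left (by omega) h.symm).symm
      · intro h
        exfalso
        apply h
        rw [Finset.mem_Icc]
        exact ⟨Nat.div_pos (Nat.le_of_dvd hνpos hdvd) (by omega), Nat.div_le_self _ _⟩
    · apply Finset.sum_eq_zero
      intro j _
      rw [if_neg]
      intro h
      exact hdvd (Dvd.intro_left _ h)
  rw [hpsum]
  refine Finset.sum_congr rfl fun π hπ => ?_
  obtain ⟨hπm, hπi, -⟩ := mem_irrMonicsLE.mp hπ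
  rw [lam_of_irreducible ψ P Q hπm hπi]
  by_cases hdvdQ : π ∣ Q
  · -- `π ∣ Q`: every root of `π` is a pole, and `λ₀(π) = 0`
    have hlam : lamIrr ψ P Q π = 0 := by unfold lamIrr; exact if_pos hdvdQ
    have hempty : ∀ x ∈ (univ.filter fun x : E => aeval x Q ≠ 0), minpoly F x = π → False := by
      intro x hx hxπ
      rw [Finset.mem_filter] at hx
      exact hx.2 ((aeval_eq_zero_iff_minpoly_dvd Q x).mpr (hxπ ▸ hdvdQ))
    rw [Finset.sum_eq_zero (fun x hx => by
      rw [Finset.mem_filter] at hx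
      exact (hempty x hx.1 hx.2).elim)]
    split_ifs with hdvd
    · rw [hlam, zero_pow (Nat.div_pos (Nat.le_of_dvd hνpos hdvd)
        (one_le_natDegree_of_irreducible hπi)).ne', mul_zero]
    · rfl
  · -- `π ∤ Q`: all roots are non-poles and contribute `λ₀(π)^{ν/d}`
    have hval : ∀ x ∈ (univ.filter fun x : E => aeval x Q ≠ 0).filter (fun x => minpoly F x = π),
        ψ (Algebra.trace F E (aeval x P / aeval x Q)) = lamIrr ψ P Q π ^ (ν / π.natDegree) := by
      intro x hx
      simp only [Finset.mem_filter, Finset.mem_univ, true_and] at hx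
      have hd : Module.finrank F⟮x⟯ E = ν / (minpoly F x).natDegree := by
        have hk : 0 < (minpoly F x).natDegree :=
          natDegree_pos_iff_degree_pos.mpr (minpoly.degree_pos (.of_finite F x))
        rw [hν, ← natDegree_minpoly_mul_finrank (F := F) x, Nat.mul_div_cancel_left _ hk]
      rw [trace_div_eq, AddChar.map_nsmul_eq_pow, hd, hx.2]
      unfold lamIrr
      rw [if_neg hdvdQ]
    rw [Finset.sum_congr rfl hval, Finset.sum_const, nsmul_eq_mul]
    have hfib : ((univ.filter fun x : E => aeval x Q ≠ 0).filter (fun x => minpoly F x = π)) =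
        univ.filter fun x : E => aeval x π = 0 := by
      ext x
      simp only [Finset.mem_filter, Finset.mem_univ, true_and]
      constructor
      · rintro ⟨-, rfl⟩
        exact minpoly.aeval F x
      · intro hx
        have hmin := minpoly_eq_of_aeval_eq_zero hπm hπi hx
        refine ⟨fun h0 => hdvdQ ?_, hmin⟩
        rw [← hmin]
        exact (aeval_eq_zero_iff_minpoly_dvd Q x).mp h0
    rw [hfib, card_filter_aeval_eq_zero hπm hπi]
    split_ifs with hdvd
    · rfl
    · rw [Nat.cast_zero, zero_mul]

omit [DecidableEq F] in
/-- `|S_E| ≤ #E`. [folklore] -/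
theorem norm_extSum_le (ψ : AddChar F ℂ) (P Q : F[X]) (E : Type*) [Field E] [Fintype E]
    [Algebra F E] : ‖extSum ψ P Q E‖ ≤ Fintype.card E := by
  classical
  unfold extSum
  refine (norm_sum_le _ _).trans ?_
  calc ∑ x ∈ univ.filter (fun x : E => aeval x Q ≠ 0), ‖ψ (Algebra.trace F E (aeval x P / aeval x Q))‖
      ≤ ∑ _x ∈ univ.filter (fun x : E => aeval x Q ≠ 0), (1 : ℝ) :=
        Finset.sum_le_sum fun x _ => (AddChar.norm_apply _ _).le
    _ = (univ.filter (fun x : E => aeval x Q ≠ 0)).card := by simp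
    _ ≤ Fintype.card E := by exact_mod_cast Finset.card_filter_le _ _

/-- **From the vanishing of the `L`-coefficients to power sums**: if `lsumOf (lam ψ P Q) n = 0`
for all `n > ℓ`, there are `ω₁, …, ω_ℓ ∈ ℂ` with `S_E = −Σᵢ ωᵢ^{[E:F]}` for every finite extension
`E/F` (Schmidt II Corollary 10D for the `L`-function of `P/Q`).
[cite: Schmidt1976, Ch. II §10, Corollary 10D] -/
theorem exists_extSum_eq_neg_powerSum (ψ : AddChar F ℂ) (P Q : F[X]) {ℓ : ℕ}
    (hvan : ∀ n, ℓ + 1 ≤ n → lsumOf (lam ψ P Q) n = 0) :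
    ∃ ω : Fin ℓ → ℂ, ∀ (E : Type*) [Field E] [Fintype E] [Algebra F E],
      extSum ψ P Q E = -∑ i, ω i ^ Module.finrank F E := by
  obtain ⟨ω, hω⟩ := HybridLFunction.exists_psumOf_eq_neg_powerSum (isMonicMul_lam ψ P Q) hvan
  refine ⟨ω, fun E _ _ _ => ?_⟩
  rw [extSum_eq_psumOf, hω _ Module.finrank_pos]

end Extension

end RationalExpSum

end Literature.NumberTheory.LFunctions
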